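import Mathlib
import Summits.Ventures.PercRepro2.SkeletonOneBranch

/-!
# (HMF) without unmarked branch vertices (blind cell PercRepro2, night-1 g16; NIGHT1-G16.md §5″)

**`HMF_of_no_branch`**: if every unmarked vertex has at most two nonzero neighbours and `a₃` has at
most one, (HMF) — hence (HCOV) — holds: cycles and necklaces with a pendant `a₃` (or `a₃` on the
cycle with one of its two coins zero), marked paths, every instance of `HMF_of_one_branch` without a
hub.  When an unmarked vertex exists it serves as the (idle) hub of `HMF_of_one_branch`; otherwise
every vertex is a mark and the reduct's neighbour of `a₃` is a mark or absent.

Own code; standard axioms.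
-/

open scoped Classical

namespace Summit.Ventures.PercRepro2

open UnionCluster CovForm

namespace Skeleton

section NoBranch

variable {V : Type*} {E : Type*} [Fintype E] [DecidableEq E] [Fintype V] [DecidableEq V]
  {R : Type*} [Field R] [LinearOrder R] [IsStrictOrderedRing R]

variable {o a₁ a₂ a₃ b : V}

/-- **(HMF) without unmarked branch vertices**: every unmarked vertex with at most two nonzero
neighbours, `a₃` with at most one nonzero neighbour, the five marks distinct ⊢ (HMF). -/
theorem HMF_of_no_branch (p : E → R) (ends : E → Sym2 V) (hp : IsProbVec p)
    (hinj : Function.Injective (Hub3.markOf3 o a₁ a₂ a₃ b))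
    (hnbr : ∀ v, v ≠ o → v ≠ a₁ → v ≠ a₂ → v ≠ a₃ → v ≠ b → (nzNbr p ends v).card ≤ 2)
    (h3 : (nzNbr p ends a₃).card ≤ 1) :
    HMF p ends o a₁ a₂ a₃ b := by
  by_cases hu : ∃ u : V, u ≠ o ∧ u ≠ a₁ ∧ u ≠ a₂ ∧ u ≠ a₃ ∧ u ≠ b
  · obtain ⟨u, huo, hu1, hu2, hu3, hub⟩ := hu
    exact HMF_of_one_branch p ends hp u huo hu1 hu2 hu3 hub hinj
      (fun v _ hvo hv1 hv2 hv3 hvb => hnbr v hvo hv1 hv2 hv3 hvb) h3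
  · -- every vertex is a mark
    have hmark : ∀ v : V, v = o ∨ v = a₁ ∨ v = a₂ ∨ v = a₃ ∨ v = b := by
      intro v
      by_contra hv
      simp only [not_or] at hv
      exact hu ⟨v, hv.1, hv.2.1, hv.2.2.1, hv.2.2.2.1, hv.2.2.2.2⟩
    have h31 : a₃ ≠ a₁ := hinj.ne (by decide : Hub.Mark.a₃ ≠ Hub.Mark.a₁)
    have h32 : a₃ ≠ a₂ := hinj.ne (by decide : Hub.Mark.a₃ ≠ Hub.Mark.a₂)
    have h3o : a₃ ≠ o := hinj.ne (by decide : Hub.Mark.a₃ ≠ Hub.Mark.o)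
    have h3b : a₃ ≠ b := hinj.ne (by decide : Hub.Mark.a₃ ≠ Hub.Mark.b)
    obtain ⟨J, hJ, hJs⟩ := exists_reduces_simple o a₁ a₂ a₃ b p ends hp
    obtain ⟨q, ends'⟩ := J
    have h3' : (nzNbr q ends' a₃).card ≤ 1 :=
      le_trans (card_nzNbr_le_of_reduces (I := (p, ends)) (J := (q, ends')) hJ a₃) h3
    obtain ⟨-, hnoloop, hnopar⟩ := hJs
    dsimp only at hnoloop hnopar
    by_cases hex : ∃ e, q e ≠ 0 ∧ a₃ ∈ ends' e
    · obtain ⟨f, hqf, haf⟩ := hex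
      obtain ⟨y, hy⟩ := Sym2.mem_iff_exists.1 haf
      have hy3 : y ≠ a₃ := by
        intro hh; subst hh
        exact hnoloop f hqf (by rw [hy]; exact Sym2.mk_isDiag_iff.2 rfl)
      have hleaf : ∀ e, q e ≠ 0 → a₃ ∈ ends' e → e = f := by
        intro e he hae
        obtain ⟨z, hz⟩ := Sym2.mem_iff_exists.1 hae
        have hyz : y = z := by
          by_contra hyz
          have hsub : ({y, z} : Finset V) ⊆ nzNbr q ends' a₃ := by
            intro w hw
            simp only [Finset.mem_insert, Finset.mem_singleton] at hw
            rw [mem_nzNbr]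
            rcases hw with rfl | rfl
            · exact ⟨f, hqf, hy⟩
            · exact ⟨e, he, hz⟩
          have := Finset.card_le_card hsub
          rw [Finset.card_pair hyz] at this
          omega
        subst hyz
        by_contra hef
        exact hnopar e f he hqf hef (by rw [hz, hy])
      rcases hmark y with hyo | hy1 | hy2 | hy3' | hyb
      · rw [hyo] at hy
        exact HMF_of_reduces_leaf_at_o hp hJ hy hqf hleaf h3o h31 h32 h3b.symm
      · rw [hy1] at hy
        exact HMF_of_reduces_leaf_at_root1 hp hJ hy hqf hleaf h31 h32 h3o.symm h3b.symm
      · rw [hy2] at hy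
        exact HMF_of_reduces_leaf_at_root2 hp hJ hy hqf hleaf h32 h31 h3o.symm h3b.symm
      · exact absurd hy3' hy3
      · rw [hyb] at hy
        exact HMF_of_reduces_leaf_at_b hp hJ hy hqf hleaf h3b h31 h32 h3o.symm
    · refine HMF_of_reduces_isolated hp hJ ?_ h31 h32 h3o.symm h3b.symm
      intro e he hae
      exact hex ⟨e, he, hae⟩

/-- (HCOV) without unmarked branch vertices, with the bound on `a₃`. -/
theorem HCov_of_no_branch (p : E → R) (ends : E → Sym2 V) (hp : IsProbVec p)
    (hinj : Function.Injective (Hub3.markOf3 o a₁ a₂ a₃ b))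
    (hnbr : ∀ v, v ≠ o → v ≠ a₁ → v ≠ a₂ → v ≠ a₃ → v ≠ b → (nzNbr p ends v).card ≤ 2)
    (h3 : (nzNbr p ends a₃).card ≤ 1) :
    HCov p ends o a₁ a₂ a₃ b :=
  HCov_of_HMF p hp ends o a₁ a₂ a₃ b (HMF_of_no_branch p ends hp hinj hnbr h3)

end NoBranch

end Skeleton

end Summit.Ventures.PercRepro2
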